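import Summits.QuantumFields.BalabanUV.Beta.GAN24.OneStepConstraintAxialLocalisation
import Summits.QuantumFields.BalabanUV.Beta.GAN24.OneStepConstraintBlockGeometry
import Summits.QuantumFields.BalabanUV.Beta.GAN24.OneStepConstraintAxialCoercivity
import Summits.QuantumFields.BalabanUV.Beta.GAN24.AveragedPropagatorInverseUniform
import Literature.MathematicalPhysics.QuantumFieldTheory.Balaban1983to89.B5Ineq110P12Lattice

/-!
# `BalabanUV.Beta.GAN24.OneStepConstraintAxialDelK` — binder row G-an2-4 ∕ (CONV-C), routes C-R6° («VALUES») × R7 («TWO CURRENCIES») × pv09's B6 torus line, PART 181 (file 2 of 2):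
# THE GAUGE-FIXED ONE-LOOP LETTER 𝒢_k = flucCov(re Δ_k, Q_ax) IS LOCALISED, k- AND VOLUME-UNIFORMLY, WITH EVERY HYPOTHESIS A TREE THEOREM.  Instantiating PART 180 at the axial tree and
# `H = re Δ_k` (`Δ_k = Beta.BlockEffectiveAction.DelK n … (fine (Lb·1) M′)`, = the lineage's `Σ_k` through PART 176): the coercivity `γ_K` from pv09's (2.153) (PART 179) with a GENERIC
# form bound `h`, the three ENDs modulo only an entry-decay letter `(h₀, δ_H)` and a site profile `Kf`, and then — with `AveragedPropagatorInverseUniform.exists_DelK_kernel_decay` (d-only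
# `c₀, δ₀`, every level, every torus) read in the block distance by PART 181 (1∕2) — the (UD) half of the REPAIRED census-V195 letter: `∃ C, m > 0` (functions of `d, Lb, a′`) with
# `|𝒢_k(x,x′)| ≤ C·e^{−m·tdist(par x, par x′)}` for EVERY coarse torus `M′`, EVERY level `n ≥ 1`, every dummy `a > 0` — census V200″ (δ), (UD)
# (unit b2b-balaban-gan24-p3, gen 60; v1)

NOT IN PRINT; OUR PROOF ([folklore] composition BY NAME: PART 178 `OneStepConstraintAxialLetters.coercive_reg_QB_axial`, PART 179 `OneStepConstraintAxialCoercivity` (`ker_coercive_reDelK_axial` = pv09's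
`B6Constraint2153QvOp.lower2153_DelK_of_QvOp` at blocking factor `Lb·1`, `reDelK_transpose`, `dotProduct_reDelK_nonneg`), PART 180 `OneStepConstraintAxialLocalisation` (`abs_effForm_le_QB_axial`,
`abs_minOp_le_QB_axial`, `abs_flucCov_le_QB_axial`), PART 181 (1∕2) `OneStepConstraintBlockGeometry` (`entry_decay_par_of_fine`, `form_le_of_entry_decay_par`, `not_corner_of_tree`), leaf-03's
`AveragedPropagatorInverseUniform.exists_DelK_kernel_decay` (pv15's `B5Kernel166Decay.kernelDecay166_succ`), r02's `B5Ineq110P12Lattice.distSite_eq_torusSupNorm`, b05's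
`Beta.VectorTailsCov.sum_exp_tdist_le` (the volume-uniform site profile), `B4Sect5Torus.rate_pos`.  [Balaban1984PropagatorsII] (2.121) p. 244, (2.152)–(2.157) pp. 249–250 LOCATE the objects
(`∫dB δ(Q̃B)δ_{Ax}(B)e^{−½⟨B,Δ_kB⟩}`, `C(C*Δ_kC)⁻¹C*`, «C*Δ_kC has the same exponential decay as Δ_k»); nothing printed is a hypothesis.)
HONEST FRAMING (cell contract, verbatim): «discharging `BetaPertH` makes Bałaban's UV stability UNCONDITIONAL — a real constructive-QFT result; it is NOT the continuum limit
and NOT the Clay problem.»  HONEST DEPENDENCY (verbatim): «continuum YM on T⁴ ⇐ BetaPertH ∧ nine spine estimates (0/9 proved); BetaPertH ⇐ (D1) ∧ (D4) ∧ CAP+tail; G-an2-4 gates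
asym, D1 and NE2/3/4.»

WHY (census V195 → V200″, gens 57–60).  V195 asked for the one-loop fluctuation-covariance letter in the lineage's INPUT-triple currency; V198′ (PART 175) showed an2's `flucCov(Σ_k, Q̃)` is
undefined (exact gauge invariance) and V199 located the repair — Bałaban's axial gauge: the STACKED constraint `Q_ax = fromRows (re QB) E_tree`, `𝒢_k = flucCov(re Δ_k, Q_ax) = C(CᵀΔ_kC)⁻¹Cᵀ`.
PARTs 176–181(1∕2) typed every letter; THIS FILE assembles them: the decay ((UD) half) of `𝒢_k` (and of `𝒮_k`, `ℋ_k`) in the lineage's own block-distance currency `tdist(par x, par x′)`,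
with constants that see neither the level `n` nor the volume `M′`.  (pv09's `cov2156_torus_DelK` ∕ PART 176 `cov2156_effForm` is the same fact for pv09's box-currency object
`bondReductionT`; here it is an2's `CompositionSingular.flucCov` — the object the lineage's composition files PARTs 105–114 ∕ 150–153 consume.)

THE OBJECTS (no `def`; spelled inline): unit torus `Tor (fine (Lb·1) M′) × Fin d`, next averaging `re (QB 1 Lb M′)`, tree bonds `T = {(x,μ) ∣ rem_ν x = 0 (ν < μ), rem_μ x + 1 < Lb}`,
`E = proj (Function.Embedding.subtype T)`, `Q_ax = fromRows (re QB 1 Lb M′) E`, `K = re Δ_k + Q_axᵀ(a′•1)Q_ax`; constants `γ₀ = gamma2153one d (Lb·1)`, `e₂ = 4Lb^{2d}(1 + Lb^{−d}) + 2·1`,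
`h = h₀·(d·Lb^d·Kf(δ_H))`, `γ_K = (max (4∕γ₀) ((4h·e₂∕γ₀ + 2e₂)∕a′))⁻¹`, then `c_K, r_F, c₀, c₁, Λ = h·e₂, r_U, m` as in PART 180.
WHAT THIS FILE PROVES (0 sorry, 0 `def`; `Lb ≥ 1`, every coarse torus `M′`, every level `n ≥ 1`, `a, a′ > 0`):
* §1 **`coercive_reg_DelK_axial_of_ub`** (`d ≥ 2`) — PART 179's regularised coercivity with a GENERIC form bound `⟨u,(re Δ_k)u⟩ ≤ h|u|²` in place of `‖Δ_k‖` (so that `γ_K` is k-uniform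
  as soon as `h` is).
* §2 (`d ≥ 2`) **`abs_effForm_le_DelK_axial`**, **`abs_minOp_le_DelK_axial`**, **`abs_flucCov_le_DelK_axial`** — PART 180's three ENDs for `H = re Δ_k` and the axial tree, modulo ONLY the
  entry-decay letter `|re Δ_k(x,x′)| ≤ h₀e^{−δ_H·tdist(par x, par x′)}` and the site profile `Kf` (symmetry, PSD, `hι`, `hUB`, `hK` all discharged).
* §3 (dimension `d + 1 ≥ 2`) **`abs_reDelK_le_par`** — the entry-decay letter DISCHARGED from a fine-site kernel decay in `torusSupNorm` currency (`h₀ = c₀e^{δ₀(Lb−1)}`, `δ_H = δ₀·Lb`), and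
  **`exists_flucCov_DelK_axial_decay`** — THE ASSEMBLED (UD) STATEMENT: `∃ C, m > 0` such that for EVERY coarse torus `M′`, EVERY `n ≥ 1` and all unit bonds `x, x′`,
  `|flucCov (re Δ_k) Q_ax (x,x′)| ≤ C·e^{−m·tdist(par x, par x′)}` — no residual hypothesis.
WHAT IT IS NOT: the (SR) half (the step rate `|𝒢_{k+1} − 𝒢_k|`, PART 172's pattern with pv09 ∕ NE2's (1.66) strip rate `abs_reDelK_sub_le`) and EL₂ are NOT here; the constants are
existential in size (d-only `c₀, δ₀` of pv15, the profile `Kf` of b05); `U = 1`, first-order MODEL framing unchanged; the identification with pv09's `bondReductionT … .cov` is not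
claimed entrywise.  SUPPLIER work; NEVER «G-an2-4 closed»; NOT (CONV-C), NOT D1, NOT `BetaPertH`, NOT continuum, NOT Clay.  Records: `HOME/b2b-balaban-gan24-p3/gen60/README.md`.
-/

noncomputable section

open scoped BigOperators Matrix ComplexOrder
open Finset Matrix

namespace Summit.QuantumFields.BalabanUV.Beta.GAN24.OneStepConstraintAxialDelK

open Literature.MathematicalPhysics.QuantumFieldTheory.Balaban1983to89
open Literature.MathematicalPhysics.QuantumFieldTheory.Balaban1983to89.B4Sect5Torus (rate rate_pos)
open Literature.MathematicalPhysics.QuantumFieldTheory.Balaban1983to89.Beta.Composition (blockProp)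
open Literature.MathematicalPhysics.QuantumFieldTheory.Balaban1983to89.Beta.CompositionSingular (effForm minOp flucCov)
open Literature.MathematicalPhysics.QuantumFieldTheory.Balaban1983to89.B5Prop11Plancherel (Tor fine)
open Literature.MathematicalPhysics.QuantumFieldTheory.Balaban1983to89.B5RealFields (reM reM_apply)
open Literature.MathematicalPhysics.QuantumFieldTheory.Balaban1983to89.Beta.VectorTailsCov (tdist tdist_comm sum_exp_tdist_le)
open Literature.MathematicalPhysics.QuantumFieldTheory.Balaban1983to89.Beta.BlockEffectiveAction (DelK)
open Literature.MathematicalPhysics.QuantumFieldTheory.Balaban1983to89.B6Cov2156TorusDelK (gamma2153one gamma2153one_pos)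
open Literature.MathematicalPhysics.QuantumFieldTheory.Balaban1983to89.B6LowerBound2153Torus (rep)
open Literature.MathematicalPhysics.QuantumFieldTheory.Balaban1983to89.B4TorusKernel.MultiPeriod (torusSupNorm)
open Literature.MathematicalPhysics.QuantumFieldTheory.Balaban1983to89.B5Prop12FieldsLattice (distSite)
open Literature.MathematicalPhysics.QuantumFieldTheory.Balaban1983to89.B5Ineq110P12Lattice (distSite_eq_torusSupNorm)
open Summit.QuantumFields.BalabanUV.T4Continuum.BalabanLineAverage (QB)
open Summit.QuantumFields.BalabanUV.T4Continuum.BalabanAveragedTowerModes (par rem)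
open Summit.QuantumFields.BalabanUV.Beta.GAN24.OneStepConstraintAxialLetters (coercive_reg_QB_axial)
open Summit.QuantumFields.BalabanUV.Beta.GAN24.OneStepConstraintAxialCoercivity (reDelK_transpose dotProduct_reDelK_nonneg ker_coercive_reDelK_axial)
open Summit.QuantumFields.BalabanUV.Beta.GAN24.OneStepConstraintAxialLocalisation (abs_effForm_le_QB_axial abs_minOp_le_QB_axial abs_flucCov_le_QB_axial)
open Summit.QuantumFields.BalabanUV.Beta.GAN24.OneStepConstraintBlockGeometry (entry_decay_par_of_fine form_le_of_entry_decay_par not_corner_of_tree)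
open Summit.QuantumFields.BalabanUV.Beta.GAN24.AveragedPropagatorInverseUniform (exists_DelK_kernel_decay)

variable {d : ℕ} (Lb : ℕ) [NeZero Lb] (M' : Fin d → ℕ) [hM' : ∀ μ, NeZero (M' μ)]
variable (n : ℕ) [NeZero n] (hn : 1 ≤ n) (a : ℝ) (ha : 0 < a)

/-! ## §1 PART 179's regularised coercivity with a generic form bound -/

section Coercivity

/-- **`coercive_reg_DelK_axial_of_ub` — THE REGULARISED COERCIVITY OF THE GAUGE-FIXED ONE-LOOP STEP, GENERIC FORM BOUND**: for `d ≥ 2`, `⟨u,(re Δ_k)u⟩ ≤ h|u|²` (`h ≥ 0`) and `a′ > 0`,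
`QGQInverse.Coercive (re Δ_k + Q_axᵀ(a′•1)Q_ax) (max (4∕γ₀) ((4h·e₂∕γ₀ + 2e₂)∕a′))⁻¹`, `γ₀ = gamma2153one d (Lb·1)`, `e₂ = 4Lb^{2d}(1 + Lb^{−d}) + 2·1` — PART 178 `coercive_reg_QB_axial` with
its kernel input PART 179 `ker_coercive_reDelK_axial` (pv09's (2.153)). [folklore] -/
theorem coercive_reg_DelK_axial_of_ub (hd : 2 ≤ d) {h : ℝ} (hh : 0 ≤ h) (hHub : ∀ u, u ⬝ᵥ (reM (DelK n hn (fine (Lb * 1) M') a ha) *ᵥ u) ≤ h * (u ⬝ᵥ u)) {a' : ℝ} (ha' : 0 < a') :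
    QGQInverse.Coercive
      (reM (DelK n hn (fine (Lb * 1) M') a ha) + (Matrix.fromRows (reM (QB 1 Lb M')) (fun (t : {x : Tor (fine (Lb * 1) M') × Fin d // (∀ ν, ν < x.2 → ((rem 1 Lb M' x.1 ν : ℕ)) = 0) ∧ ((rem 1 Lb M' x.1 x.2 : ℕ)) + 1 < Lb}) (x : Tor (fine (Lb * 1) M') × Fin d) => if x = (Function.Embedding.subtype (fun x : Tor (fine (Lb * 1) M') × Fin d => (∀ ν, ν < x.2 → ((rem 1 Lb M' x.1 ν : ℕ)) = 0) ∧ ((rem 1 Lb M' x.1 x.2 : ℕ)) + 1 < Lb)) t then (1 : ℝ) else 0))ᵀ * (a' • (1 : Matrix ((Tor (fine 1 M') × Fin d) ⊕ {x : Tor (fine (Lb * 1) M') × Fin d // (∀ ν, ν < x.2 → ((rem 1 Lb M' x.1 ν : ℕ)) = 0) ∧ ((rem 1 Lb M' x.1 x.2 : ℕ)) + 1 < Lb}) ((Tor (fine 1 M') × Fin d) ⊕ {x : Tor (fine (Lb * 1) M') × Fin d // (∀ ν, ν < x.2 → ((rem 1 Lb M' x.1 ν : ℕ)) = 0) ∧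 ((rem 1 Lb M' x.1 x.2 : ℕ)) + 1 < Lb}) ℝ)) * Matrix.fromRows (reM (QB 1 Lb M')) (fun (t : {x : Tor (fine (Lb * 1) M') × Fin d // (∀ ν, ν < x.2 → ((rem 1 Lb M' x.1 ν : ℕ)) = 0) ∧ ((rem 1 Lb M' x.1 x.2 : ℕ)) + 1 < Lb}) (x : Tor (fine (Lb * 1) M') × Fin d) => if x = (Function.Embedding.subtype (fun x : Tor (fine (Lb * 1) M') × Fin d => (∀ ν, ν < x.2 → ((rem 1 Lb M' x.1 ν : ℕ)) = 0) ∧ ((rem 1 Lb M' x.1 x.2 : ℕ)) + 1 < Lb)) t then (1 : ℝ) else 0))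
      (max (4 / gamma2153one d (Lb * 1)) ((4 * h * (4 * ((Lb : ℝ) ^ d) ^ 2 * (1 + ((Lb : ℝ) ^ d)⁻¹) + 2 * 1) / gamma2153one d (Lb * 1) + 2 * (4 * ((Lb : ℝ) ^ d) ^ 2 * (1 + ((Lb : ℝ) ^ d)⁻¹) + 2 * 1)) / a'))⁻¹ :=
  coercive_reg_QB_axial 1 Lb M' (reDelK_transpose Lb M' n hn a ha) (dotProduct_reDelK_nonneg Lb M' n hn a ha) hh hHub
    (gamma2153one_pos (le_trans (by norm_num) hd) (Nat.one_le_iff_ne_zero.2 (NeZero.ne (Lb * 1))))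
    (fun z hQ hE => ker_coercive_reDelK_axial Lb M' n hn a ha hd z hQ (fun t => by
      have h := congrFun hE t
      rw [StackedConstraintLetters.proj_mulVec, Pi.zero_apply] at h
      exact h)) ha'

end Coercivity

/-! ## §2 The three ENDs for `H = re Δ_k`, modulo the entry-decay letter and the site profile -/

section Ends

/-- **`abs_effForm_le_DelK_axial` — THE GAUGE-FIXED EFFECTIVE FORM OF THE ONE-LOOP STEP IS LOCALISED** (`d ≥ 2`; PART 180 `abs_effForm_le_QB_axial` at `H = re Δ_k`, the axial tree; `hι`, `hUB`, `hK` discharged by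
PART 181 (1∕2) ∕ §1): `|𝒮_k(b,b′)| ≤ (2(Λ+a′)+a′)·e^{−r_U·tdist(key b, key b′)}`, constants independent of `n` and `M′` once `(h₀, δ_H, Kf)` are. [folklore] -/
theorem abs_effForm_le_DelK_axial (hd : 2 ≤ d) {Kf : ℝ → ℝ} (hKf0 : ∀ s : ℝ, 0 < s → 0 ≤ Kf s)
    (hKf : ∀ s : ℝ, 0 < s → ∀ y : Tor (fine 1 M'), ∑ y' : Tor (fine 1 M'), Real.exp (-(s * (tdist y y' : ℝ))) ≤ Kf s)
    {h₀ δH : ℝ} (hh₀ : 0 ≤ h₀) (hδH : 0 < δH)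
    (hHent : ∀ x x', |reM (DelK n hn (fine (Lb * 1) M') a ha) x x'| ≤ h₀ * Real.exp (-(δH * (tdist (par 1 Lb M' x.1) (par 1 Lb M' x'.1) : ℝ))))
    {a' : ℝ} (ha' : 0 < a') {h γK cK rF c₀ Λ rU : ℝ} (hh : h = h₀ * ((d : ℝ) * (Lb : ℝ) ^ d * Kf δH))
    (hγK : γK = (max (4 / gamma2153one d (Lb * 1)) ((4 * h * (4 * ((Lb : ℝ) ^ d) ^ 2 * (1 + ((Lb : ℝ) ^ d)⁻¹) + 2 * 1) / gamma2153one d (Lb * 1) + 2 * (4 * ((Lb : ℝ) ^ d) ^ 2 * (1 + ((Lb : ℝ) ^ d)⁻¹) + 2 * 1)) / a'))⁻¹)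
    (hcK : cK = (h₀ + a' * ((((Lb : ℝ)) ^ d)⁻¹ * (((Lb : ℝ)) ^ d)⁻¹) * Real.exp (2 * δH)) + a')
    (hrF : rF = rate (fun s => (d : ℝ) * (Lb : ℝ) ^ d * Kf s) γK cK δH) (hc₀ : c₀ = 2 / γK * Real.exp (2 * rF))
    (hΛ : Λ = h * (4 * ((Lb : ℝ) ^ d) ^ 2 * (1 + ((Lb : ℝ) ^ d)⁻¹) + 2 * 1)) (hrU : rU = rate (fun s => (d : ℝ) * (1 + (Lb : ℝ) ^ d) * Kf s) (Λ + a')⁻¹ c₀ rF)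
    (b b' : (Tor (fine 1 M') × Fin d) ⊕ {x : Tor (fine (Lb * 1) M') × Fin d // (∀ ν, ν < x.2 → ((rem 1 Lb M' x.1 ν : ℕ)) = 0) ∧ ((rem 1 Lb M' x.1 x.2 : ℕ)) + 1 < Lb}) :
    |effForm (reM (DelK n hn (fine (Lb * 1) M') a ha)) (Matrix.fromRows (reM (QB 1 Lb M')) (fun (t : {x : Tor (fine (Lb * 1) M') × Fin d // (∀ ν, ν < x.2 → ((rem 1 Lb M' x.1 ν : ℕ)) = 0) ∧ ((rem 1 Lb M' x.1 x.2 : ℕ)) + 1 < Lb}) (x : Tor (fine (Lb * 1) M') × Fin d) => if x = (Function.Embedding.subtype (fun x : Tor (fine (Lb * 1) M') × Fin d => (∀ ν, ν < x.2 → ((rem 1 Lb M' x.1 ν : ℕ)) = 0) ∧ ((rem 1 Lb M' x.1 x.2 : ℕ)) + 1 < Lb)) t then (1 : ℝ) else 0)) b b'| ≤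
      (2 * (Λ + a') + a') * Real.exp (-(rU * (tdist ((Sum.elim (fun b : Tor (fine 1 M') × Fin d => b.1) (fun t : {x : Tor (fine (Lb * 1) M') × Fin d // (∀ ν, ν < x.2 → ((rem 1 Lb M' x.1 ν : ℕ)) = 0) ∧ ((rem 1 Lb M' x.1 x.2 : ℕ)) + 1 < Lb} => par 1 Lb M' ((Function.Embedding.subtype (fun x : Tor (fine (Lb * 1) M') × Fin d => (∀ ν, ν < x.2 → ((rem 1 Lb M' x.1 ν : ℕ)) = 0) ∧ ((rem 1 Lb M' x.1 x.2 : ℕ)) + 1 < Lb)) t).1)) b) ((Sum.elim (fun b : Tor (fine 1 M') × Fin d => b.1) (fun t : {x : Tor (fine (Lb * 1) M') × Fin d // (∀ ν, ν < x.2 → ((rem 1 Lb M' x.1 ν : ℕ)) = 0) ∧ ((rem 1 Lb M' x.1 x.2 : ℕ)) + 1 < Lb} => par 1 Lb M' ((Function.Embedding.subtype (fun x : Tor (fine (Lb * 1) M') × Fin d => (∀ ν, ν < x.2 → ((rem 1 Lb M' x.1 ν : ℕ)) = 0) ∧ ((rem 1 Lb M' x.1 x.2 : ℕ)) + 1 <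 Lb)) t).1)) b') : ℝ))) := by
  have hι := not_corner_of_tree 1 Lb M'
  have hh0 : 0 ≤ h := by rw [hh]; have := hKf0 δH hδH; positivity
  have hHub := form_le_of_entry_decay_par 1 Lb M' (reDelK_transpose Lb M' n hn a ha) hKf hh₀ hδH hHent
  simp_rw [← hh] at hHub
  have hγK0 : 0 < γK := by
    rw [hγK]
    exact inv_pos.mpr (lt_of_lt_of_le (div_pos four_pos (gamma2153one_pos (le_trans (by norm_num) hd) (Nat.one_le_iff_ne_zero.2 (NeZero.ne (Lb * 1))))) (le_max_left _ _))
  have hK := coercive_reg_DelK_axial_of_ub Lb M' n hn a ha hd hh0 hHub ha'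
  rw [← hγK] at hK
  exact abs_effForm_le_QB_axial 1 Lb M' (Function.Embedding.subtype (fun x : Tor (fine (Lb * 1) M') × Fin d => (∀ ν, ν < x.2 → ((rem 1 Lb M' x.1 ν : ℕ)) = 0) ∧ ((rem 1 Lb M' x.1 x.2 : ℕ)) + 1 < Lb)) hι hKf0 hKf (reDelK_transpose Lb M' n hn a ha) (dotProduct_reDelK_nonneg Lb M' n hn a ha) hh0 hHub hγK0 ha' hh₀ hδH hK hHent
    hcK hrF hc₀ hΛ hrU b b'

/-- **`abs_minOp_le_DelK_axial` — THE GAUGE-FIXED HARD MINIMISER HAS LOCALISED COLUMNS** (`d ≥ 2`; PART 180 `abs_minOp_le_QB_axial` at `H = re Δ_k`):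
`|ℋ_k(x,b)| ≤ 2(Λ+a′)·c₁·(d(1+Lb^d)Kf(m∕2))·e^{−(m∕2)·tdist(par x, key b)}`. [folklore] -/
theorem abs_minOp_le_DelK_axial (hd : 2 ≤ d) {Kf : ℝ → ℝ} (hKf0 : ∀ s : ℝ, 0 < s → 0 ≤ Kf s)
    (hKf : ∀ s : ℝ, 0 < s → ∀ y : Tor (fine 1 M'), ∑ y' : Tor (fine 1 M'), Real.exp (-(s * (tdist y y' : ℝ))) ≤ Kf s)
    {h₀ δH : ℝ} (hh₀ : 0 ≤ h₀) (hδH : 0 < δH)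
    (hHent : ∀ x x', |reM (DelK n hn (fine (Lb * 1) M') a ha) x x'| ≤ h₀ * Real.exp (-(δH * (tdist (par 1 Lb M' x.1) (par 1 Lb M' x'.1) : ℝ))))
    {a' : ℝ} (ha' : 0 < a') {h γK cK rF c₀ c₁ Λ rU m : ℝ} (hh : h = h₀ * ((d : ℝ) * (Lb : ℝ) ^ d * Kf δH))
    (hγK : γK = (max (4 / gamma2153one d (Lb * 1)) ((4 * h * (4 * ((Lb : ℝ) ^ d) ^ 2 * (1 + ((Lb : ℝ) ^ d)⁻¹) + 2 * 1) / gamma2153one d (Lb * 1) + 2 * (4 * ((Lb : ℝ) ^ d) ^ 2 * (1 + ((Lb : ℝ) ^ d)⁻¹) + 2 * 1)) / a'))⁻¹)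
    (hcK : cK = (h₀ + a' * ((((Lb : ℝ)) ^ d)⁻¹ * (((Lb : ℝ)) ^ d)⁻¹) * Real.exp (2 * δH)) + a')
    (hrF : rF = rate (fun s => (d : ℝ) * (Lb : ℝ) ^ d * Kf s) γK cK δH) (hc₀ : c₀ = 2 / γK * Real.exp (2 * rF)) (hc₁ : c₁ = 2 / γK * Real.exp rF)
    (hΛ : Λ = h * (4 * ((Lb : ℝ) ^ d) ^ 2 * (1 + ((Lb : ℝ) ^ d)⁻¹) + 2 * 1)) (hrU : rU = rate (fun s => (d : ℝ) * (1 + (Lb : ℝ) ^ d) * Kf s) (Λ + a')⁻¹ c₀ rF) (hm : m = min rF rU)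
    (x : Tor (fine (Lb * 1) M') × Fin d) (b : (Tor (fine 1 M') × Fin d) ⊕ {x : Tor (fine (Lb * 1) M') × Fin d // (∀ ν, ν < x.2 → ((rem 1 Lb M' x.1 ν : ℕ)) = 0) ∧ ((rem 1 Lb M' x.1 x.2 : ℕ)) + 1 < Lb}) :
    |minOp (reM (DelK n hn (fine (Lb * 1) M') a ha)) (Matrix.fromRows (reM (QB 1 Lb M')) (fun (t : {x : Tor (fine (Lb * 1) M') × Fin d // (∀ ν, ν < x.2 → ((rem 1 Lb M' x.1 ν : ℕ)) = 0) ∧ ((rem 1 Lb M' x.1 x.2 : ℕ)) + 1 < Lb}) (x : Tor (fine (Lb * 1) M') × Fin d) => if x = (Function.Embedding.subtype (fun x : Tor (fine (Lb * 1) M') × Fin d => (∀ ν, ν < x.2 → ((rem 1 Lb M' x.1 ν : ℕ)) = 0) ∧ ((rem 1 Lb M' x.1 x.2 : ℕ)) + 1 < Lb)) t then (1 : ℝ) else 0)) x b| ≤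
      2 * (Λ + a') * c₁ * ((d : ℝ) * (1 + (Lb : ℝ) ^ d) * Kf (m / 2)) * Real.exp (-(m / 2 * (tdist (par 1 Lb M' x.1) ((Sum.elim (fun b : Tor (fine 1 M') × Fin d => b.1) (fun t : {x : Tor (fine (Lb * 1) M') × Fin d // (∀ ν, ν < x.2 → ((rem 1 Lb M' x.1 ν : ℕ)) = 0) ∧ ((rem 1 Lb M' x.1 x.2 : ℕ)) + 1 < Lb} => par 1 Lb M' ((Function.Embedding.subtype (fun x : Tor (fine (Lb * 1) M') × Fin d => (∀ ν, ν < x.2 → ((rem 1 Lb M' x.1 ν : ℕ)) = 0) ∧ ((rem 1 Lb M' x.1 x.2 : ℕ)) + 1 < Lb)) t).1)) b) : ℝ))) := by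
  have hι := not_corner_of_tree 1 Lb M'
  have hh0 : 0 ≤ h := by rw [hh]; have := hKf0 δH hδH; positivity
  have hHub := form_le_of_entry_decay_par 1 Lb M' (reDelK_transpose Lb M' n hn a ha) hKf hh₀ hδH hHent
  simp_rw [← hh] at hHub
  have hγK0 : 0 < γK := by
    rw [hγK]
    exact inv_pos.mpr (lt_of_lt_of_le (div_pos four_pos (gamma2153one_pos (le_trans (by norm_num) hd) (Nat.one_le_iff_ne_zero.2 (NeZero.ne (Lb * 1))))) (le_max_left _ _))
  have hK := coercive_reg_DelK_axial_of_ub Lb M' n hn a ha hd hh0 hHub ha'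
  rw [← hγK] at hK
  exact abs_minOp_le_QB_axial 1 Lb M' (Function.Embedding.subtype (fun x : Tor (fine (Lb * 1) M') × Fin d => (∀ ν, ν < x.2 → ((rem 1 Lb M' x.1 ν : ℕ)) = 0) ∧ ((rem 1 Lb M' x.1 x.2 : ℕ)) + 1 < Lb)) hι hKf0 hKf (reDelK_transpose Lb M' n hn a ha) (dotProduct_reDelK_nonneg Lb M' n hn a ha) hh0 hHub hγK0 ha' hh₀ hδH hK hHent
    hcK hrF hc₀ hc₁ hΛ hrU hm x b

/-- **`abs_flucCov_le_DelK_axial` — THE GAUGE-FIXED FLUCTUATION COVARIANCE `𝒢_k = flucCov(re Δ_k, Q_ax)` IS LOCALISED IN THE BLOCK DISTANCE** (`d ≥ 2`; PART 180 `abs_flucCov_le_QB_axial` at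
`H = re Δ_k`, the axial tree; symmetry, PSD, `hι`, `hUB`, `hK` discharged — the only inputs left are the entry-decay letter `(h₀, δ_H)` and the profile `Kf`):
`|𝒢_k(x,x′)| ≤ (2∕γ_K + 2(Λ+a′)c₁²(d(1+Lb^d)Kf(m∕2))(d(1+Lb^d)Kf(m∕4)))·e^{−min r_F (m∕4)·tdist(par x, par x′)}`. [folklore] -/
theorem abs_flucCov_le_DelK_axial (hd : 2 ≤ d) {Kf : ℝ → ℝ} (hKf0 : ∀ s : ℝ, 0 < s → 0 ≤ Kf s)
    (hKf : ∀ s : ℝ, 0 < s → ∀ y : Tor (fine 1 M'), ∑ y' : Tor (fine 1 M'), Real.exp (-(s * (tdist y y' : ℝ))) ≤ Kf s)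
    {h₀ δH : ℝ} (hh₀ : 0 ≤ h₀) (hδH : 0 < δH)
    (hHent : ∀ x x', |reM (DelK n hn (fine (Lb * 1) M') a ha) x x'| ≤ h₀ * Real.exp (-(δH * (tdist (par 1 Lb M' x.1) (par 1 Lb M' x'.1) : ℝ))))
    {a' : ℝ} (ha' : 0 < a') {h γK cK rF c₀ c₁ Λ rU m : ℝ} (hh : h = h₀ * ((d : ℝ) * (Lb : ℝ) ^ d * Kf δH))
    (hγK : γK = (max (4 / gamma2153one d (Lb * 1)) ((4 * h * (4 * ((Lb : ℝ) ^ d) ^ 2 * (1 + ((Lb : ℝ) ^ d)⁻¹) + 2 * 1) / gamma2153one d (Lb * 1) + 2 * (4 * ((Lb : ℝ) ^ d) ^ 2 * (1 + ((Lb : ℝ) ^ d)⁻¹) + 2 * 1)) / a'))⁻¹)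
    (hcK : cK = (h₀ + a' * ((((Lb : ℝ)) ^ d)⁻¹ * (((Lb : ℝ)) ^ d)⁻¹) * Real.exp (2 * δH)) + a')
    (hrF : rF = rate (fun s => (d : ℝ) * (Lb : ℝ) ^ d * Kf s) γK cK δH) (hc₀ : c₀ = 2 / γK * Real.exp (2 * rF)) (hc₁ : c₁ = 2 / γK * Real.exp rF)
    (hΛ : Λ = h * (4 * ((Lb : ℝ) ^ d) ^ 2 * (1 + ((Lb : ℝ) ^ d)⁻¹) + 2 * 1)) (hrU : rU = rate (fun s => (d : ℝ) * (1 + (Lb : ℝ) ^ d) * Kf s) (Λ + a')⁻¹ c₀ rF) (hm : m = min rF rU)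
    (x x' : Tor (fine (Lb * 1) M') × Fin d) :
    |flucCov (reM (DelK n hn (fine (Lb * 1) M') a ha)) (Matrix.fromRows (reM (QB 1 Lb M')) (fun (t : {x : Tor (fine (Lb * 1) M') × Fin d // (∀ ν, ν < x.2 → ((rem 1 Lb M' x.1 ν : ℕ)) = 0) ∧ ((rem 1 Lb M' x.1 x.2 : ℕ)) + 1 < Lb}) (x : Tor (fine (Lb * 1) M') × Fin d) => if x = (Function.Embedding.subtype (fun x : Tor (fine (Lb * 1) M') × Fin d => (∀ ν, ν < x.2 → ((rem 1 Lb M' x.1 ν : ℕ)) = 0) ∧ ((rem 1 Lb M' x.1 x.2 : ℕ)) + 1 < Lb)) t then (1 : ℝ) else 0)) x x'| ≤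
      (2 / γK + 2 * (Λ + a') * c₁ ^ 2 * ((d : ℝ) * (1 + (Lb : ℝ) ^ d) * Kf (m / 2)) * ((d : ℝ) * (1 + (Lb : ℝ) ^ d) * Kf (m / 4))) *
        Real.exp (-(min rF (m / 4) * (tdist (par 1 Lb M' x.1) (par 1 Lb M' x'.1) : ℝ))) := by
  have hι := not_corner_of_tree 1 Lb M'
  have hh0 : 0 ≤ h := by rw [hh]; have := hKf0 δH hδH; positivity
  have hHub := form_le_of_entry_decay_par 1 Lb M' (reDelK_transpose Lb M' n hn a ha) hKf hh₀ hδH hHent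
  simp_rw [← hh] at hHub
  have hγK0 : 0 < γK := by
    rw [hγK]
    exact inv_pos.mpr (lt_of_lt_of_le (div_pos four_pos (gamma2153one_pos (le_trans (by norm_num) hd) (Nat.one_le_iff_ne_zero.2 (NeZero.ne (Lb * 1))))) (le_max_left _ _))
  have hK := coercive_reg_DelK_axial_of_ub Lb M' n hn a ha hd hh0 hHub ha'
  rw [← hγK] at hK
  exact abs_flucCov_le_QB_axial 1 Lb M' (Function.Embedding.subtype (fun x : Tor (fine (Lb * 1) M') × Fin d => (∀ ν, ν < x.2 → ((rem 1 Lb M' x.1 ν : ℕ)) = 0) ∧ ((rem 1 Lb M' x.1 x.2 : ℕ)) + 1 < Lb)) hι hKf0 hKf (reDelK_transpose Lb M' n hn a ha) (dotProduct_reDelK_nonneg Lb M' n hn a ha) hh0 hHub hγK0 ha' hh₀ hδH hK hHent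
    hcK hrF hc₀ hc₁ hΛ hrU hm x x'

end Ends

/-! ## §3 Dimension `d + 1`: the entry-decay letter discharged; the assembled (UD) statement -/

section Assembled

variable (M₁ : Fin (d + 1) → ℕ) [hM₁ : ∀ μ, NeZero (M₁ μ)]

omit hM' in
/-- `torusSupNorm` of representatives IS the lineage's `tdist` (r02's `distSite_eq_torusSupNorm`; `distSite` and `VectorTailsCov.tdist` agree definitionally). [folklore] -/
theorem torusSupNorm_rep_sub_rep (s s' : Tor (fine (Lb * 1) M₁)) :
    torusSupNorm (fine (Lb * 1) M₁) (rep (fine (Lb * 1) M₁) s - rep (fine (Lb * 1) M₁) s') = (tdist s s' : ℝ) := by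
  rw [← distSite_eq_torusSupNorm, tdist_comm]
  rfl

omit hM' in
/-- **`abs_reDelK_le_par` — THE ENTRY-DECAY LETTER, DISCHARGED SHAPE**: a kernel decay of `Δ_k` in the fine-site torus sup-distance, `‖Δ_k(q′,q)‖ ≤ c₀e^{−δ₀|rep q′ − rep q|_T}` (`c₀, δ₀ ≥ 0`),
gives PART 180's letter in the block distance: `|re Δ_k(x,x′)| ≤ c₀e^{δ₀(Lb−1)}·e^{−(δ₀Lb)·tdist(par x, par x′)}` (PART 181 (1∕2) `entry_decay_par_of_fine`). [folklore] -/
theorem abs_reDelK_le_par {c₀ δ₀ : ℝ} (hc₀ : 0 ≤ c₀) (hδ₀ : 0 ≤ δ₀)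
    (hker : ∀ q' q : Tor (fine (Lb * 1) M₁) × Fin (d + 1), ‖DelK n hn (fine (Lb * 1) M₁) a ha q' q‖ ≤
      c₀ * Real.exp (-(δ₀ * torusSupNorm (fine (Lb * 1) M₁) (rep (fine (Lb * 1) M₁) q'.1 - rep (fine (Lb * 1) M₁) q.1))))
    (x x' : Tor (fine (Lb * 1) M₁) × Fin (d + 1)) :
    |reM (DelK n hn (fine (Lb * 1) M₁) a ha) x x'| ≤ c₀ * Real.exp (δ₀ * ((Lb : ℝ) - 1)) * Real.exp (-(δ₀ * Lb * (tdist (par 1 Lb M₁ x.1) (par 1 Lb M₁ x'.1) : ℝ))) := by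
  refine entry_decay_par_of_fine 1 Lb M₁ (H := reM (DelK n hn (fine (Lb * 1) M₁) a ha)) hc₀ hδ₀ (fun q' q => ?_) x x'
  rw [reM_apply, ← torusSupNorm_rep_sub_rep]
  exact (Complex.abs_re_le_norm _).trans (hker q' q)

/-- **`exists_flucCov_DelK_axial_decay` — THE (UD) HALF OF THE REPAIRED ONE-LOOP LETTER, ASSEMBLED, NO RESIDUAL HYPOTHESIS**: in dimension `d + 1 ≥ 2`, for every blocking factor `Lb ≥ 1`
and all dummies `a, a′ > 0` there are `C` and `m > 0` (functions of `d, Lb, a′`: pv15's d-only kernel-decay constants of `Δ_k`, b05's volume-uniform site profile, PART 180's closed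
expressions) such that for EVERY coarse torus `M′`, EVERY level `n ≥ 1` and all unit-lattice bonds `x, x′` the gauge-fixed fluctuation covariance of the one-loop step,
`𝒢_k = flucCov (re Δ_k) (fromRows (re QB 1 Lb M′) E_tree)` (an2's `CompositionSingular.flucCov`; Bałaban's `C(C*Δ_kC)⁻¹C*` of (2.156)), satisfies `|𝒢_k(x,x′)| ≤ C·e^{−m·tdist(par x, par x′)}`.
[folklore] -/
theorem exists_flucCov_DelK_axial_decay (hd : 1 ≤ d) {a' : ℝ} (ha' : 0 < a') :
    ∃ C m : ℝ, 0 < m ∧ ∀ (M₁ : Fin (d + 1) → ℕ) [∀ μ, NeZero (M₁ μ)] (n : ℕ) [NeZero n] (hn : 1 ≤ n) (x x' : Tor (fine (Lb * 1) M₁) × Fin (d + 1)),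
      |flucCov (reM (DelK n hn (fine (Lb * 1) M₁) a ha)) (Matrix.fromRows (reM (QB 1 Lb M₁)) (fun (t : {x : Tor (fine (Lb * 1) M₁) × Fin (d + 1) // (∀ ν, ν < x.2 → ((rem 1 Lb M₁ x.1 ν : ℕ)) = 0) ∧ ((rem 1 Lb M₁ x.1 x.2 : ℕ)) + 1 < Lb}) (x : Tor (fine (Lb * 1) M₁) × Fin (d + 1)) => if x = (Function.Embedding.subtype (fun x : Tor (fine (Lb * 1) M₁) × Fin (d + 1) => (∀ ν, ν < x.2 → ((rem 1 Lb M₁ x.1 ν : ℕ)) = 0) ∧ ((rem 1 Lb M₁ x.1 x.2 : ℕ)) + 1 < Lb)) t then (1 : ℝ) else 0)) x x'| ≤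
        C * Real.exp (-(m * (tdist (par 1 Lb M₁ x.1) (par 1 Lb M₁ x'.1) : ℝ))) := by
  have hd' : 2 ≤ d + 1 := by omega
  have hLb : (1 : ℝ) ≤ Lb := by exact_mod_cast Nat.one_le_iff_ne_zero.2 (NeZero.ne Lb)
  -- the d-only kernel decay of `Δ_k`
  obtain ⟨c₀, δ₀, hc₀, hδ₀, hker⟩ := exists_DelK_kernel_decay (d := d)
  -- the volume-uniform site profile
  have hex : ∀ s : ℝ, ∃ S : ℝ, 0 ≤ S ∧ (0 < s → ∀ (N : Fin (d + 1) → ℕ) [∀ μ, NeZero (N μ)] (y : (μ : Fin (d + 1)) → ZMod (N μ)),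
      ∑ y', Real.exp (-(s * (tdist y y' : ℝ))) ≤ S) := by
    intro s
    by_cases hs : 0 < s
    · obtain ⟨S, hS0, hS⟩ := sum_exp_tdist_le (d := d + 1) hd' hs
      exact ⟨S, hS0, fun _ => hS⟩
    · exact ⟨0, le_rfl, fun h => absurd h hs⟩
  choose Kf hKf0' hKf' using hex
  have hKf0 : ∀ s : ℝ, 0 < s → 0 ≤ Kf s := fun s _ => hKf0' s
  -- the letters and PART 180's constants
  set h₀ : ℝ := c₀ * Real.exp (δ₀ * ((Lb : ℝ) - 1)) with hh₀
  set δH : ℝ := δ₀ * Lb with hδH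
  have hh₀0 : 0 ≤ h₀ := by positivity
  have hδH0 : 0 < δH := by rw [hδH]; positivity
  set h : ℝ := h₀ * (((d + 1 : ℕ) : ℝ) * (Lb : ℝ) ^ (d + 1) * Kf δH) with hh
  set γK : ℝ := (max (4 / gamma2153one (d + 1) (Lb * 1)) ((4 * h * (4 * ((Lb : ℝ) ^ (d + 1)) ^ 2 * (1 + ((Lb : ℝ) ^ (d + 1))⁻¹) + 2 * 1) / gamma2153one (d + 1) (Lb * 1)
    + 2 * (4 * ((Lb : ℝ) ^ (d + 1)) ^ 2 * (1 + ((Lb : ℝ) ^ (d + 1))⁻¹) + 2 * 1)) / a'))⁻¹ with hγK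
  set cK : ℝ := (h₀ + a' * ((((Lb : ℝ)) ^ (d + 1))⁻¹ * (((Lb : ℝ)) ^ (d + 1))⁻¹) * Real.exp (2 * δH)) + a' with hcK
  set rF : ℝ := rate (fun s => ((d + 1 : ℕ) : ℝ) * (Lb : ℝ) ^ (d + 1) * Kf s) γK cK δH with hrF
  set c₀' : ℝ := 2 / γK * Real.exp (2 * rF) with hc₀'
  set c₁ : ℝ := 2 / γK * Real.exp rF with hc₁
  set Λ : ℝ := h * (4 * ((Lb : ℝ) ^ (d + 1)) ^ 2 * (1 + ((Lb : ℝ) ^ (d + 1))⁻¹) + 2 * 1) with hΛ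
  set rU : ℝ := rate (fun s => ((d + 1 : ℕ) : ℝ) * (1 + (Lb : ℝ) ^ (d + 1)) * Kf s) (Λ + a')⁻¹ c₀' rF with hrU
  set m : ℝ := min rF rU with hm
  -- positivity of the rates
  have hγ₀ : 0 < gamma2153one (d + 1) (Lb * 1) := gamma2153one_pos (by omega) (Nat.one_le_iff_ne_zero.2 (NeZero.ne (Lb * 1)))
  have hγK0 : 0 < γK := inv_pos.mpr (lt_of_lt_of_le (div_pos four_pos hγ₀) (le_max_left _ _))
  have hh0 : 0 ≤ h := by rw [hh]; have := hKf0' δH; positivity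
  have hcK0 : 0 ≤ cK := by rw [hcK]; positivity
  have hprofF : ∀ s : ℝ, 0 < s → 0 ≤ ((d + 1 : ℕ) : ℝ) * (Lb : ℝ) ^ (d + 1) * Kf s := fun s hs => by have := hKf0' s; positivity
  have hprofU : ∀ s : ℝ, 0 < s → 0 ≤ ((d + 1 : ℕ) : ℝ) * (1 + (Lb : ℝ) ^ (d + 1)) * Kf s := fun s hs => by have := hKf0' s; positivity
  have hrF0 : 0 < rF := rate_pos hprofF hγK0 hcK0 hδH0
  have hΛ0 : 0 ≤ Λ := by rw [hΛ]; positivity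
  have hc₀'0 : 0 ≤ c₀' := by positivity
  have hrU0 : 0 < rU := rate_pos hprofU (inv_pos.mpr (by positivity)) hc₀'0 hrF0
  have hm0 : 0 < m := lt_min hrF0 hrU0
  refine ⟨2 / γK + 2 * (Λ + a') * c₁ ^ 2 * (((d + 1 : ℕ) : ℝ) * (1 + (Lb : ℝ) ^ (d + 1)) * Kf (m / 2)) * (((d + 1 : ℕ) : ℝ) * (1 + (Lb : ℝ) ^ (d + 1)) * Kf (m / 4)),
    min rF (m / 4), lt_min hrF0 (by positivity), fun M₁ _ n _ hn x x' => ?_⟩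
  have hHent := abs_reDelK_le_par Lb n hn a ha M₁ hc₀.le hδ₀.le (fun q' q => hker n hn (fine (Lb * 1) M₁) a ha q' q)
  exact abs_flucCov_le_DelK_axial Lb M₁ n hn a ha hd' hKf0 (fun s hs y => hKf' s hs (fine 1 M₁) y) hh₀0 hδH0 hHent ha' hh hγK hcK hrF hc₀' hc₁ hΛ hrU hm x x'

end Assembled

end Summit.QuantumFields.BalabanUV.Beta.GAN24.OneStepConstraintAxialDelK

end
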